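/-
Copyright (c) 2026 the pub-hodgecm-mathlib formalisation cell (harness21).  Prover seat hodgecm-mathlib-K2Liu-p12 (g0): Track B «K2-LIT»,
#184♮ = hLiu418 = stmt-HodgeConjecture-24832; Road Φ of socket #41, organ Φ5 «bad finite places» (LEAD F0P6-plan (g13) rulings «M-157c∕h»), the TIE.
-/
import Summits.HodgeConjecture.HodgeConjecture.Theorems.K2LiuBadPlaceWhittakerFarShells   -- ★ F4b-1: `setIntegral_farShell_eq_zero`
import Summits.HodgeConjecture.HodgeConjecture.Theorems.K2LiuBadPlaceWhittakerHeads       -- ★ F4b-2: ball formula, entire, bound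
import Summits.HodgeConjecture.HodgeConjecture.Theorems.K2LiuSkewLatticeShells           -- ★ F3b (K2Liu-p08): balls∕shells∕Levi preservation∕pull-back regularity
import HarnessLib

/-!
# Crux `HLiu418`, Road Φ of socket #41, organ Φ5 — THE TIE: the bad-place local Whittaker coefficient is ONE ball integral, for every `s` (entire for flat families)

Cell `hodgecm-mathlib`, crux item hLiu418 = `stmt-HodgeConjecture-24832`, route of record `HCCMUnconditional`; squad K2 ∕ K2Liu, road `K2_Liu`,
socket #41 `sig_K2LiuSiegelEisensteinContinuation`, Road Φ, organ Φ5 «bad finite places» (K2Liu-p12 files ★ F1 `K2LiuShellVanishingByAveraging`,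
★ F2 `K2LiuShellStabilization`, ★ F4a `K2LiuBadPlaceWhittakerShells`, ★ F3a `K2LiuLocalLeviSupply`, ★ F3c-1 `K2LiuLocalRingValuationBalls`,
★ F3c-2 `K2LiuWhittakerCharacterMoves`, ★ F4b-1 `K2LiuBadPlaceWhittakerFarShells`, ★ F4b-2 `K2LiuBadPlaceWhittakerHeads`; K2Liu-p08 (g2) ★ F3b
`K2LiuSkewLatticeShells`).  THEOREMS ONLY (no `def`, no `instance`, no `notation`, no named-fact hypothesis, no `sorry`); lane
`--supports stmt-HodgeConjecture-24832` (count-neutral helper; closes no socket by itself).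

THE TIE discharges the six lattice∕regularity hypotheses-by-shape of ★ F4b-1 (`hBm hBfin hB0 hpre hφm hφC`) by ★ F3b's `measurableSet_ball`,
`measure_ball_ne_top`, `measure_ball_ne_zero`, `preimage_ball_eq_of_integral`, `measurable_pullback`, `exists_bound_pullback_of_isCompact` +
`isCompact_ball` (the sections `f s` being CONTINUOUS — smooth sections are, ★ F3b `continuous_of_rightInvariant`), and chains it with ★ F4b-2:
* **`whittaker_setIntegral_ball_eq`** — there is `K₁` (independent of the Fourier index `β` and of `s`) such that for `β` `T`-skew with `ββ⁻ = 1`,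
  `β ∈ ball(−b)`, `β⁻ ∈ ball(−b′)`, and EVERY `s`, the ball integrals `∫_{B(−k)} f s (w_Δ n(t))·ψ_v(−τ tr(β t)) dμ` are INDEPENDENT of `k ≥ K₁ + 4b + 2b′ − 1`:
  the bad-place local Whittaker coefficient `W_{β,v}(f_s) := ∫_{B(−(K₁+4b+2b′−1))} …` is a compact-ball integral for all `s` (Karel's lemma), equal to
  `∫_S …` wherever the latter is absolutely convergent (`whittaker_integral_eq_setIntegral_ball`);
* **`differentiable_whittaker`** — it is ENTIRE in `s` as soon as `s ↦ f s g` is entire for each `g` and locally uniformly bounded on each ball (the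
  `K_v`-flat families; ★ F4b-2 `differentiable_setIntegral_ball`), with the bound ★ F4b-2 `norm_setIntegral_ball_le` (polynomial in `β` through
  `K₁ + 4·ord β + 2·ord β⁻¹`) and the lattice support ★ F4a `setIntegral_eq_zero_of_unipotent_translate`.

## References
* [Casselman1980] W. Casselman, *The unramified principal series of p-adic groups I*, Compositio Math. 40 (1980), §3.
* [KudlaRallis1994] S. Kudla, S. Rallis, Ann. of Math. 140 (1994), §2.   * [Shimura1997] G. Shimura, CBMS 93 (1997), §18.
-/

set_option autoImplicit false
-- the mandated namespace repeats the single-problem summit's segment (`HodgeConjecture.HodgeConjecture`)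
set_option linter.dupNamespace false

noncomputable section

open scoped NNReal ENNReal Matrix Topology
open NumberField IsDedekindDomain Matrix MeasureTheory Set Filter Metric
open Literature.NumberTheory.Automorphic Literature.NumberTheory.Automorphic.UnitaryGroup
open Literature.NumberTheory.GelbartRogawski1991.AdaptedBlocks
open Literature.NumberTheory.GelbartRogawski1991.UnitaryDualPair.LocalSplitting
open Literature.NumberTheory.K2Lit.LocalSiegelDoubled
open Summit.HodgeConjecture.HodgeConjecture.Cruxes.HLiu418.K2LiuBadPlaceWhittakerFarShells
open Summit.HodgeConjecture.HodgeConjecture.Cruxes.HLiu418.K2LiuBadPlaceWhittakerHeads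
open Summit.HodgeConjecture.HodgeConjecture.Cruxes.HLiu418.K2LiuSkewLatticeShells

namespace Summit.HodgeConjecture.HodgeConjecture.Cruxes.HLiu418.K2LiuBadPlaceWhittakerEntire

variable (F : Type) [Field F] [NumberField F] (E : Type) [Field E] [NumberField E] [Algebra F E]
  [Algebra.IsQuadraticExtension F E] (c : E ≃ₐ[F] E)
  {δ : E} (hcδ : c δ = -δ) (hδ : δ ≠ 0) {dd : F} (hd : δ * δ = algebraMap F E dd)
  (v : HeightOneSpectrum (𝓞 F)) (n : ℕ) {T₀ : Matrix (Fin n) (Fin n) F} (hT₀ : T₀.IsSymm) (hT₀d : IsUnit T₀.det)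
  {JD : Matrix (Fin (n + n)) (Fin (n + n)) E} (hJD : JD = (gramD F n T₀).map (algebraMap F E))
  {π : v.adicCompletion F} (hπ : Valued.v π = WithZero.exp (-1 : ℤ))

include hcδ hδ hd hT₀ hT₀d hJD hπ in
/-- **THE BAD-PLACE LOCAL WHITTAKER COEFFICIENT IS ONE BALL INTEGRAL, FOR EVERY `s`** (Karel's lemma; unconditional over the tree).  Data as in ★ F4b-1
`setIntegral_farShell_eq_zero`, with CONTINUOUS sections `f s` (the lattice and regularity hypotheses are discharged by ★ F3b): there is `K₁` such that for
`β` `T`-skew, `ββ⁻ = 1`, `β ∈ ball(−b)`, `β⁻ ∈ ball(−b′)` (`0 ≤ b, b′`, `2b_T ≤ b`), every `s` and every `k ≥ K₁ + 4b + 2b′ − 1`: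
`∫_{B(−k)} f s (w_Δ n(t))·ψ_v(−τ tr(β t)) dμ = ∫_{B(−(K₁+4b+2b′−1))} f s (w_Δ n(t))·ψ_v(−τ tr(β t)) dμ`.
[cite: Casselman1980, §3] [cite: KudlaRallis1994, §2] [cite: Shimura1997, §18] -/
theorem whittaker_setIntegral_ball_eq
    (S : AddSubgroup (Matrix (Fin n) (Fin n) (LocalRing E v)))
    (hS : ∀ t, t ∈ S ↔ (t.map (conjLocal E c v))ᵀ * gramS F E v n T₀ + gramS F E v n T₀ * t = 0)
    [MeasurableSpace S] [BorelSpace S] [LocallyCompactSpace S] (μ : Measure S) [μ.IsAddHaarMeasure] [μ.Regular]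
    [MeasurableSpace (v.adicCompletion F)] [BorelSpace (v.adicCompletion F)] (μF : Measure (v.adicCompletion F)) [μF.IsAddHaarMeasure]
    {χv : ∀ w : PlacesOver E v, (w.1.adicCompletion E)ˣ →* ℂˣ}
    (hχv : ∀ w : PlacesOver E v, ∃ V ∈ 𝓝 (1 : w.1.adicCompletion E), ∀ x ∈ V, ∀ hx : IsUnit x, χv w hx.unit = 1)
    {U : Subgroup (UnitaryGroup.localPi E c (n + n) JD v)} (hU : IsOpen (U : Set (UnitaryGroup.localPi E c (n + n) JD v)))
    {f : ℂ → UnitaryGroup.localPi E c (n + n) JD v → ℂ} (hf : ∀ s, IsLocalSiegelSection F E c hcδ hδ hd v n hT₀ hJD χv s (f s))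
    (hfU : ∀ s g k, k ∈ U → f s (g * k) = f s g) (hfc : ∀ s, Continuous (f s))
    {ψ : AddChar (v.adicCompletion F) Circle} (hψ : Continuous ψ) {d : ℤ} (hdψ : ψ.HasConductorExp d)
    {τ : LocalRing E v → v.adicCompletion F} (hτ : ∀ r, toLocalRing E v (τ r) = r + conjLocal E c v r) (hτadd : ∀ r s, τ (r + s) = τ r + τ s)
    (hτs : ∀ (z : v.adicCompletion F) (r : LocalRing E v), τ (toLocalRing E v z * r) = z * τ r) (hτc : Continuous τ)
    {ε : LocalRing E v} (hεσ : conjLocal E c v ε = -ε) (hεint : ∀ w : PlacesOver E v, Valued.v (ε w) ≤ 1) {cε c₂ bT : ℤ}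
    (hε : ∀ w : PlacesOver E v, Valued.v (toPlace v w π) ^ cε ≤ Valued.v ((2 * ε) w))
    (h2 : ∀ w : PlacesOver E v, Valued.v (toPlace v w π) ^ c₂ ≤ Valued.v ((2 : LocalRing E v) w))
    (hTb : ∀ i j (w : PlacesOver E v), Valued.v (gramS F E v n T₀ i j w) ≤ Valued.v (toPlace v w π) ^ (-bT))
    (hTib : ∀ i j (w : PlacesOver E v), Valued.v ((gramS F E v n T₀)⁻¹ i j w) ≤ Valued.v (toPlace v w π) ^ (-bT)) :
    ∃ K₁ : ℤ, ∀ (b b' : ℤ) (β βinv : Matrix (Fin n) (Fin n) (LocalRing E v)), 0 ≤ b → 0 ≤ b' → 2 * bT ≤ b →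
      (β.map (conjLocal E c v))ᵀ * gramS F E v n T₀ + gramS F E v n T₀ * β = 0 → β * βinv = 1 →
      (∀ i j (w : PlacesOver E v), Valued.v (β i j w) ≤ Valued.v (toPlace v w π) ^ (-b)) →
      (∀ i j (w : PlacesOver E v), Valued.v (βinv i j w) ≤ Valued.v (toPlace v w π) ^ (-b')) →
      ∀ s : ℂ, ∀ k : ℤ, K₁ + 4 * b + 2 * b' - 1 ≤ k →
        ∫ t in {t : S | ∀ i j (w : PlacesOver E v), Valued.v (t.1 i j w) ≤ Valued.v (toPlace v w π) ^ (-k)},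
            f s (weylDelta F E c v n hJD * nElem F E c v n hJD t.1 ((hS t.1).1 t.2)) * ((ψ (-τ (Matrix.trace (β * t.1))) : Circle) : ℂ) ∂μ =
          ∫ t in {t : S | ∀ i j (w : PlacesOver E v), Valued.v (t.1 i j w) ≤ Valued.v (toPlace v w π) ^ (-(K₁ + 4 * b + 2 * b' - 1))},
            f s (weylDelta F E c v n hJD * nElem F E c v n hJD t.1 ((hS t.1).1 t.2)) * ((ψ (-τ (Matrix.trace (β * t.1))) : Circle) : ℂ) ∂μ := by
  -- the lattice and regularity hypotheses of ★ F4b-1, by ★ F3b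
  have hBm := fun a : ℤ => measurableSet_ball F E v hπ n S a
  have hBfin := fun a : ℤ => measure_ball_ne_top F E c v hπ n S hS μ a
  have hB0 := measure_ball_ne_zero F E c v hπ n S hS μ 0
  have hφm : ∀ s, Measurable fun t : S => f s (weylDelta F E c v n hJD * nElem F E c v n hJD t.1 ((hS t.1).1 t.2)) := fun s =>
    measurable_pullback F E c v n hJD S hS (hfc s)
  have hφC : ∀ s (k : ℤ), ∃ C : ℝ, ∀ t : S, (∀ i j (w : PlacesOver E v), Valued.v (t.1 i j w) ≤ Valued.v (toPlace v w π) ^ (-k)) →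
      ‖f s (weylDelta F E c v n hJD * nElem F E c v n hJD t.1 ((hS t.1).1 t.2))‖ ≤ C := fun s k =>
    exists_bound_pullback_of_isCompact F E c v n hJD S hS (hfc s) (isCompact_ball F E c v hπ n S hS (-k))
  obtain ⟨K₁, hK₁⟩ := setIntegral_farShell_eq_zero F E c hcδ hδ hd v n hT₀ hT₀d hJD hπ S hS μ μF hχv hU hf hfU hφm hφC hψ hdψ hτ hτadd hτs hτc
    hεσ hεint hε h2 hTb hTib hBm hBfin hB0
    (fun L A D' A' D'' hL hL' hA hD' hA' hD'' a => preimage_ball_eq_of_integral F E v hπ n S L hL hL' hA hD' hA' hD'' a)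
  refine ⟨K₁, fun b b' β βinv hb hb' hbTb hβskew hββ hβ hβinv s k hk => ?_⟩
  have hshell := hK₁ b b' β βinv hb hb' hbTb hβskew hββ hβ hβinv
  have hχcont : Continuous fun t : S => ((ψ (-τ (Matrix.trace (β * t.1))) : Circle) : ℂ) :=
    continuous_subtype_val.comp (hψ.comp (hτc.comp (continuous_const.matrix_mul continuous_subtype_val).matrix_trace).neg)
  have h := setIntegral_ball_eq_of_farShell μ
    (B := fun a : ℤ => {t : S | ∀ i j (w : PlacesOver E v), Valued.v (t.1 i j w) ≤ Valued.v (toPlace v w π) ^ a}) hBm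
    (fun _ _ haa' => ball_antitone F E v hπ n S haa') hBfin
    (φ := fun s (t : S) => f s (weylDelta F E c v n hJD * nElem F E c v n hJD t.1 ((hS t.1).1 t.2)))
    (χ := fun t : S => ((ψ (-τ (Matrix.trace (β * t.1))) : Circle) : ℂ)) hφm hχcont.measurable (fun t => by rw [Circle.norm_coe])
    (fun s a => by
      obtain ⟨C, hC⟩ := exists_bound_pullback_of_isCompact F E c v n hJD S hS (hfc s) (isCompact_ball F E c v hπ n S hS a)
      exact ⟨C, hC⟩)
    (K := K₁ + 4 * b + 2 * b') (fun s k hk => hshell k hk s) s hk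
  exact h

omit [Algebra.IsQuadraticExtension F E] in
include hπ in
/-- **… and it is the whole Whittaker integral where that converges absolutely** (`φ_s·χ_β ∈ L¹(S)`, e.g. `Re s` large): `∫_S = ∫_{B(−(K−1))}` given the far-shell
vanishing beyond `K` (apply with the `K₁ + 4b + 2b′` of `whittaker_setIntegral_ball_eq` ∕ ★ F4b-1). [cite: Casselman1980, §3] [cite: Shimura1997, §18] -/
theorem whittaker_integral_eq_setIntegral_ball (S : AddSubgroup (Matrix (Fin n) (Fin n) (LocalRing E v)))
    [MeasurableSpace S] [BorelSpace S] (μ : Measure S) {φ : ℂ → S → ℂ} {χ : S → ℂ} {K : ℤ}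
    (hshell : ∀ s (k : ℤ), K ≤ k →
      ∫ t in {t : S | ∀ i j (w : PlacesOver E v), Valued.v (t.1 i j w) ≤ Valued.v (toPlace v w π) ^ (-k)} \
          {t : S | ∀ i j (w : PlacesOver E v), Valued.v (t.1 i j w) ≤ Valued.v (toPlace v w π) ^ (-k + 1)}, φ s t * χ t ∂μ = 0)
    (s : ℂ) (hint : Integrable (fun t => φ s t * χ t) μ) :
    ∫ t, φ s t * χ t ∂μ = ∫ t in {t : S | ∀ i j (w : PlacesOver E v), Valued.v (t.1 i j w) ≤ Valued.v (toPlace v w π) ^ (-(K - 1))}, φ s t * χ t ∂μ :=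
  integral_eq_setIntegral_ball_of_farShell μ
    (B := fun a : ℤ => {t : S | ∀ i j (w : PlacesOver E v), Valued.v (t.1 i j w) ≤ Valued.v (toPlace v w π) ^ a})
    (fun a => measurableSet_ball F E v hπ n S a) (fun _ _ haa' => ball_antitone F E v hπ n S haa') (fun t => exists_mem_ball F E v hπ n S t) hshell s hint

omit [Algebra.IsQuadraticExtension F E] in
include hJD hπ in
/-- **ENTIRE**: for CONTINUOUS sections with `s ↦ f s g` entire for every `g` and locally (in `s`) uniformly bounded along the pull-back on the ball (the
`K_v`-flat Siegel families), the ball integral `s ↦ ∫_{B a} f s (w_Δ n(t))·ψ_v(−τ tr(β t)) dμ` is `Differentiable ℂ` — with `whittaker_setIntegral_ball_eq`,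
the bad-place local Whittaker coefficient is ENTIRE. [cite: KudlaRallis1994, §2] [cite: Shimura1997, §18] -/
theorem differentiable_whittaker (S : AddSubgroup (Matrix (Fin n) (Fin n) (LocalRing E v)))
    (hS : ∀ t, t ∈ S ↔ (t.map (conjLocal E c v))ᵀ * gramS F E v n T₀ + gramS F E v n T₀ * t = 0)
    [MeasurableSpace S] [BorelSpace S] (μ : Measure S) [μ.IsAddHaarMeasure]
    {f : ℂ → UnitaryGroup.localPi E c (n + n) JD v → ℂ} (hfc : ∀ s, Continuous (f s))
    (hdiff : ∀ g, Differentiable ℂ fun s => f s g)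
    (a : ℤ) (hbd : ∀ s₀ : ℂ, ∃ r > 0, ∃ C : ℝ, ∀ s ∈ ball s₀ r,
      ∀ t ∈ {t : S | ∀ i j (w : PlacesOver E v), Valued.v (t.1 i j w) ≤ Valued.v (toPlace v w π) ^ a},
        ‖f s (weylDelta F E c v n hJD * nElem F E c v n hJD t.1 ((hS t.1).1 t.2))‖ ≤ C)
    {ψ : AddChar (v.adicCompletion F) Circle} (hψ : Continuous ψ) {τ : LocalRing E v → v.adicCompletion F} (hτc : Continuous τ)
    (β : Matrix (Fin n) (Fin n) (LocalRing E v)) :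
    Differentiable ℂ fun s => ∫ t in {t : S | ∀ i j (w : PlacesOver E v), Valued.v (t.1 i j w) ≤ Valued.v (toPlace v w π) ^ a},
      f s (weylDelta F E c v n hJD * nElem F E c v n hJD t.1 ((hS t.1).1 t.2)) * ((ψ (-τ (Matrix.trace (β * t.1))) : Circle) : ℂ) ∂μ := by
  have hχcont : Continuous fun t : S => ((ψ (-τ (Matrix.trace (β * t.1))) : Circle) : ℂ) :=
    continuous_subtype_val.comp (hψ.comp (hτc.comp (continuous_const.matrix_mul continuous_subtype_val).matrix_trace).neg)
  exact differentiable_setIntegral_ball μ (measurableSet_ball F E v hπ n S a) (measure_ball_ne_top F E c v hπ n S hS μ a)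
    (φ := fun s (t : S) => f s (weylDelta F E c v n hJD * nElem F E c v n hJD t.1 ((hS t.1).1 t.2)))
    (fun t => (hdiff _)) (fun s => measurable_pullback F E c v n hJD S hS (hfc s)) hχcont.measurable (fun t => by rw [Circle.norm_coe]) hbd

end Summit.HodgeConjecture.HodgeConjecture.Cruxes.HLiu418.K2LiuBadPlaceWhittakerEntire

end
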